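import Mathlib
import Literature.Computability.AlgebraicComplexity.ArithCircuit
import Literature.Computability.AlgebraicComplexity.BurgisserBooleanParts
import HarnessLib

/-!
# Route NumTame — clamped complex fixed-point semantics of an arithmetic circuit
# (route-posited objects for crux `TameA3`, stmt-ValiantsHypothesis-5386)

The registered proof skeleton of crux `NumTame.TameA3` (line `birth`,
`Cruxes/TameA3/Lines/birth.lean`; skeleton-register 2026-08-17) splits the archimedean, GRH-free
Boolean-part step of Bürgisser's transfer ("tame fan-in-two `ℂ`-circuits computing `φ_n` on the cube
⇒ polynomial-size `B₂`-circuits for the bits of `φ_n`") into an ERROR-RECURSION stub and a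
BOOLEAN-ENGINEERING stub.  Both speak about one shared object, which this file re-homes VERBATIM
from the skeleton so that `Theorems/` files can import it (a `Cruxes/…/Lines/` file carries
`sorry` and is never imported):

* `FixedPoint.clamp M z` — overflow clamp (keep `z` if both components lie in `(-2^M, 2^M)`,
  else `0`); `FixedPoint.rshift B z` — arithmetic right shift (floor division by `2^B` in both
  components); `FixedPoint.ofComplex B a` — nearest grid point numerator `round (a · 2^B)`;
* `FixedPoint.operandFx / gateFx / gateValuesFx / evalFx` — the clamped fixed-point run of an
  `ArithCircuit ℂ σ` at a Boolean point in format `I` integer / `B` fractional bits (a Gaussian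
  integer `z` stands for `z / 2^B`; junk gate references read `0`, exactly as `Operand.eval`);
* `FixedPoint.outNat P I B x = ⌊Re(evalFx)/2^B + 1/2⌋⁺` — the run rounded to a natural number;
* the bit encodings the Boolean half reads: `FixedPoint.wordBits W z` (two's complement word of
  width `W` of an integer, realised as the bits of `(z : ZMod (2^W)).val` so that the tree's
  modular-arithmetic gadgets `HasBits.add/mul` of `BurgisserBooleanPartsModPCircuits` apply),
  `FixedPoint.gaussBits` (the two words of a Gaussian integer) and the bus `FixedPoint.fxBus`
  (Boolean inputs followed by the words of a list of Gaussian integers);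

and records the definitional API (`gateValuesFx_append_singleton`, lengths, clamp range lemmas)
plus the seam's rounding lemma `FixedPoint.toNat_round_eq` (proved in the skeleton, copied).

Honest framing: plumbing for the conditional route NumTame (its crux `TameNF` and `NP ⊄ P/poly`
stay open); `VP ≠ VNP` is NOT proved and nothing here bears on it.

## References

* P. Bürgisser, *Cook's versus Valiant's hypothesis*, Theoret. Comput. Sci. 235 (2000), §5 (A3)
  (Boolean parts by simulating straight-line programs). [cite: Burgisser2000TCS, §5 (A3)]
* P. Koiran, *A weak version of the Blum, Shub & Smale model*, J. Comput. System Sci. 54 (1997)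
  (bit-cost simulation of straight-line programs). [cite: Koiran1997]
* L. Blum, F. Cucker, M. Shub, S. Smale, *Complexity and Real Computation* (1998), Ch. 4
  (round-off in straight-line computation).
-/

set_option linter.dupNamespace false

noncomputable section

namespace Summit.ValiantsHypothesis.ValiantsHypothesis.Theorems.NumTame

open Literature.Computability.AlgebraicComplexity

/-! ## Clamped complex fixed-point semantics (format `I` integer bits, `B` fractional bits; every
value is a Gaussian integer `z` standing for `z / 2^B`) — verbatim from `Cruxes/TameA3/Lines/birth.lean` -/

namespace FixedPoint

open ArithCircuit

/-- Overflow clamp of the format: keep `z` if both components lie in `(-2^M, 2^M)`, else `0`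
(line `birth` of crux `TameA3`). [folklore] -/
def clamp (M : ℕ) (z : GaussianInt) : GaussianInt :=
  if |z.re| < 2 ^ M ∧ |z.im| < 2 ^ M then z else 0

/-- Arithmetic right shift by `B` bits in both components (floor division by `2^B`). [folklore] -/
def rshift (B : ℕ) (z : GaussianInt) : GaussianInt :=
  ⟨z.re / 2 ^ B, z.im / 2 ^ B⟩

/-- The nearest point of the grid `2^{-B} ℤ[i]` to `a`, as its numerator. [folklore] -/
def ofComplex (B : ℕ) (a : ℂ) : GaussianInt :=
  ⟨round (a.re * 2 ^ B), round (a.im * 2 ^ B)⟩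

variable {σ : Type*}

/-- Fixed-point value of an operand (junk gate references read `0`, as in `Operand.eval`). [folklore] -/
def operandFx (I B : ℕ) (x : σ → Bool) (vals : List GaussianInt) : Operand ℂ σ → GaussianInt
  | .var i => if x i then clamp (I + B) (2 ^ B) else 0
  | .const a => clamp (I + B) (ofComplex B a)
  | .gate j => vals.getD j 0

/-- Fixed-point value of a gate: rounded weights, products rescaled by `rshift B`, every result
clamped to the format. [folklore] -/
def gateFx (I B : ℕ) (x : σ → Bool) (vals : List GaussianInt) : Gate ℂ σ → GaussianInt
  | .sum args => clamp (I + B)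
      ((args.map fun a => rshift B (clamp (I + B) (ofComplex B a.1) * operandFx I B x vals a.2)).sum)
  | .prod args => args.foldl
      (fun acc u => clamp (I + B) (rshift B (acc * operandFx I B x vals u))) (clamp (I + B) (2 ^ B))

/-- Fixed-point values of a gate list (left fold, as `gateValues`). [folklore] -/
def gateValuesFx (I B : ℕ) (x : σ → Bool) (gs : List (Gate ℂ σ)) : List GaussianInt :=
  gs.foldl (fun vals g => vals ++ [gateFx I B x vals g]) []

/-- Fixed-point value of the output operand of `P` at the Boolean point `x`. [folklore] -/
def evalFx (P : ArithCircuit ℂ σ) (I B : ℕ) (x : σ → Bool) : GaussianInt :=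
  operandFx I B x (gateValuesFx I B x P.gates) P.output

/-- The simulated output rounded to the nearest natural number: `⌊Re(evalFx)/2^B + 1/2⌋⁺`. [folklore] -/
def outNat (P : ArithCircuit ℂ σ) (I B : ℕ) (x : σ → Bool) : ℕ :=
  Int.toNat ((2 * (evalFx P I B x).re + 2 ^ B) / 2 ^ (B + 1))

/-! ## Definitional API -/

/-- The empty gate list has no fixed-point values. [folklore] -/
@[simp] theorem gateValuesFx_nil (I B : ℕ) (x : σ → Bool) :
    gateValuesFx I B x ([] : List (Gate ℂ σ)) = [] := rfl

/-- Appending one gate appends its fixed-point value computed against the earlier ones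
(mirror of `ArithCircuit.gateValues_append_singleton`). [folklore] -/
theorem gateValuesFx_append_singleton (I B : ℕ) (x : σ → Bool) (gs : List (Gate ℂ σ))
    (g : Gate ℂ σ) :
    gateValuesFx I B x (gs ++ [g]) =
      gateValuesFx I B x gs ++ [gateFx I B x (gateValuesFx I B x gs) g] := by
  simp [gateValuesFx, List.foldl_append]

/-- The fixed-point run produces one value per gate. [folklore] -/
@[simp] theorem length_gateValuesFx (I B : ℕ) (x : σ → Bool) (gs : List (Gate ℂ σ)) :
    (gateValuesFx I B x gs).length = gs.length := by
  induction gs using List.reverseRecOn with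
  | nil => rfl
  | append_singleton gs g ih => simp [gateValuesFx_append_singleton, ih]

/-- A value inside the format is not clamped. [folklore] -/
theorem clamp_eq_self {M : ℕ} {z : GaussianInt} (hre : |z.re| < 2 ^ M) (him : |z.im| < 2 ^ M) :
    clamp M z = z := by
  simp [clamp, hre, him]

/-- The clamp lands in the format (real part). [folklore] -/
theorem abs_re_clamp_lt (M : ℕ) (z : GaussianInt) : |(clamp M z).re| < 2 ^ M := by
  unfold clamp
  split_ifs with h
  · exact h.1
  · simp

/-- The clamp lands in the format (imaginary part). [folklore] -/
theorem abs_im_clamp_lt (M : ℕ) (z : GaussianInt) : |(clamp M z).im| < 2 ^ M := by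
  unfold clamp
  split_ifs with h
  · exact h.2
  · simp

/-- Real part of the shift. [folklore] -/
@[simp] theorem rshift_re (B : ℕ) (z : GaussianInt) : (rshift B z).re = z.re / 2 ^ B := rfl

/-- Imaginary part of the shift. [folklore] -/
@[simp] theorem rshift_im (B : ℕ) (z : GaussianInt) : (rshift B z).im = z.im / 2 ^ B := rfl

/-- Real part of the rounded constant. [folklore] -/
@[simp] theorem ofComplex_re (B : ℕ) (a : ℂ) : (ofComplex B a).re = round (a.re * 2 ^ B) := rfl

/-- Imaginary part of the rounded constant. [folklore] -/
@[simp] theorem ofComplex_im (B : ℕ) (a : ℂ) : (ofComplex B a).im = round (a.im * 2 ^ B) := rfl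

/-- Every value of the fixed-point run is a clamp output or the clamped scale `2^B`, hence lies
in the format: real parts. [folklore] -/
theorem abs_re_gateFx_lt (I B : ℕ) (x : σ → Bool) (vals : List GaussianInt) (g : Gate ℂ σ) :
    |(gateFx I B x vals g).re| < 2 ^ (I + B) := by
  cases g with
  | sum args => exact abs_re_clamp_lt _ _
  | prod args =>
    simp only [gateFx]
    suffices h : ∀ (l : List (Operand ℂ σ)) (acc : GaussianInt), |acc.re| < 2 ^ (I + B) →
        |(l.foldl (fun acc u => clamp (I + B) (rshift B (acc * operandFx I B x vals u))) acc).re|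
          < 2 ^ (I + B) from h args _ (abs_re_clamp_lt _ _)
    intro l
    induction l with
    | nil => intro acc h; simpa using h
    | cons u l ih => intro acc _; exact ih _ (abs_re_clamp_lt _ _)

/-- Every value of the fixed-point run lies in the format: imaginary parts. [folklore] -/
theorem abs_im_gateFx_lt (I B : ℕ) (x : σ → Bool) (vals : List GaussianInt) (g : Gate ℂ σ) :
    |(gateFx I B x vals g).im| < 2 ^ (I + B) := by
  cases g with
  | sum args => exact abs_im_clamp_lt _ _
  | prod args =>
    simp only [gateFx]
    suffices h : ∀ (l : List (Operand ℂ σ)) (acc : GaussianInt), |acc.im| < 2 ^ (I + B) →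
        |(l.foldl (fun acc u => clamp (I + B) (rshift B (acc * operandFx I B x vals u))) acc).im|
          < 2 ^ (I + B) from h args _ (abs_im_clamp_lt _ _)
    intro l
    induction l with
    | nil => intro acc h; simpa using h
    | cons u l ih => intro acc _; exact ih _ (abs_im_clamp_lt _ _)

/-- All values of the run of a gate list lie in the format. [folklore] -/
theorem abs_lt_of_mem_gateValuesFx (I B : ℕ) (x : σ → Bool) (gs : List (Gate ℂ σ))
    (z : GaussianInt) (hz : z ∈ gateValuesFx I B x gs) :
    |z.re| < 2 ^ (I + B) ∧ |z.im| < 2 ^ (I + B) := by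
  induction gs using List.reverseRecOn with
  | nil => simp at hz
  | append_singleton gs g ih =>
    rw [gateValuesFx_append_singleton, List.mem_append, List.mem_singleton] at hz
    rcases hz with hz | rfl
    · exact ih hz
    · exact ⟨abs_re_gateFx_lt _ _ _ _ _, abs_im_gateFx_lt _ _ _ _ _⟩

/-- Operands of the run lie in the format whenever the value list does. [folklore] -/
theorem abs_operandFx_lt (I B : ℕ) (x : σ → Bool) (vals : List GaussianInt)
    (hvals : ∀ z ∈ vals, |z.re| < 2 ^ (I + B) ∧ |z.im| < 2 ^ (I + B)) (u : Operand ℂ σ) :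
    |(operandFx I B x vals u).re| < 2 ^ (I + B) ∧ |(operandFx I B x vals u).im| < 2 ^ (I + B) := by
  cases u with
  | var i =>
    simp only [operandFx]
    split_ifs
    · exact ⟨abs_re_clamp_lt _ _, abs_im_clamp_lt _ _⟩
    · simp
  | const a => exact ⟨abs_re_clamp_lt _ _, abs_im_clamp_lt _ _⟩
  | gate j =>
    simp only [operandFx, List.getD_eq_getElem?_getD]
    by_cases hj : j < vals.length
    · rw [List.getElem?_eq_getElem hj]
      exact hvals _ (List.getElem_mem hj)
    · rw [List.getElem?_eq_none (not_lt.1 hj)]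
      simp

/-! ## Two's complement words and the bus read by the Boolean half -/

/-- Two's complement word of width `W` of the integer `z`: bit `i < W` of `z mod 2^W`, realised
through `ZMod (2^W)` so that modular-arithmetic circuit gadgets apply verbatim (Vollmer 1999,
§1.3: binary and two's complement representations). [folklore] -/
def wordBits (W : ℕ) (z : ℤ) : Fin W → Bool := fun i => ((z : ZMod (2 ^ W))).val.testBit i

/-- The two words (real part on `false`, imaginary part on `true`) of a Gaussian integer. [folklore] -/
def gaussBits (W : ℕ) (z : GaussianInt) : Bool × Fin W → Bool :=
  fun bi => wordBits W (if bi.1 then z.im else z.re) bi.2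

/-- The bus of the Boolean simulation after `m` values: the Boolean inputs `x`, then the two
words of each of `ws[0], …, ws[m-1]` (junk index ↦ the words of `0`). [folklore] -/
def fxBus (W : ℕ) (x : σ → Bool) (ws : List GaussianInt) (m : ℕ) :
    σ ⊕ (Fin m × (Bool × Fin W)) → Bool :=
  Sum.elim x fun w => gaussBits W (ws.getD w.1 0) w.2

/-- Unfolding the input part of the bus. [folklore] -/
@[simp] theorem fxBus_inl (W : ℕ) (x : σ → Bool) (ws : List GaussianInt) (m : ℕ) (i : σ) :
    fxBus W x ws m (Sum.inl i) = x i := rfl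

/-- Unfolding the word part of the bus. [folklore] -/
@[simp] theorem fxBus_inr (W : ℕ) (x : σ → Bool) (ws : List GaussianInt) (m : ℕ)
    (w : Fin m × (Bool × Fin W)) :
    fxBus W x ws m (Sum.inr w) = gaussBits W (ws.getD w.1 0) w.2 := rfl

/-! ## The seam's rounding lemma (copied from the skeleton) -/

/-- Rounding lemma: if the fixed-point number `z / 2^B` is within `1/2` of a natural number `m`
(in complex norm), then rounding its real part to the nearest integer,
`⌊(2·z.re + 2^B) / 2^(B+1)⌋⁺`, returns `m`. [folklore] -/
theorem toNat_round_eq {z : GaussianInt} {B m : ℕ}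
    (h : ‖GaussianInt.toComplex z / (2 : ℂ) ^ B - (m : ℂ)‖ < 1 / 2) :
    Int.toNat ((2 * z.re + 2 ^ B) / 2 ^ (B + 1)) = m := by
  have hre : (GaussianInt.toComplex z / (2 : ℂ) ^ B - (m : ℂ)).re = (z.re : ℝ) / (2 : ℝ) ^ B - m := by
    have h2 : (2 : ℂ) ^ B = ((2 ^ B : ℕ) : ℂ) := by push_cast; rfl
    rw [Complex.sub_re, h2, Complex.div_natCast_re, ← GaussianInt.intCast_re, Complex.natCast_re]
    push_cast
    rfl
  have habs : |(z.re : ℝ) / (2 : ℝ) ^ B - m| < 1 / 2 := by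
    rw [← hre]
    exact (Complex.abs_re_le_norm _).trans_lt h
  have hpos : (0 : ℝ) < (2 : ℝ) ^ B := by positivity
  rw [abs_lt] at habs
  obtain ⟨h1, h2⟩ := habs
  have h1' : (m : ℝ) * 2 ^ (B + 1) < 2 * z.re + 2 ^ B := by
    rw [pow_succ]
    have key : ((m : ℝ) - 1 / 2) * 2 ^ B < (z.re : ℝ) := by
      rw [← lt_div_iff₀ hpos]; linarith
    nlinarith
  have h2' : (2 * z.re + 2 ^ B : ℝ) < ((m : ℝ) + 1) * 2 ^ (B + 1) := by
    rw [pow_succ]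
    have key : (z.re : ℝ) < ((m : ℝ) + 1 / 2) * 2 ^ B := by
      rw [← div_lt_iff₀ hpos]; linarith
    nlinarith
  have i1 : (m : ℤ) * 2 ^ (B + 1) < 2 * z.re + 2 ^ B := by exact_mod_cast h1'
  have i2 : 2 * z.re + 2 ^ B < ((m : ℤ) + 1) * 2 ^ (B + 1) := by exact_mod_cast h2'
  have hq : (2 * z.re + 2 ^ B) / 2 ^ (B + 1) = (m : ℤ) := by
    have hp : (0 : ℤ) < 2 ^ (B + 1) := by positivity
    apply le_antisymm
    · have := (Int.ediv_lt_iff_lt_mul hp).2 i2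
      omega
    · exact (Int.le_ediv_iff_mul_le hp).2 i1.le
  rw [hq, Int.toNat_natCast]

end FixedPoint

end Summit.ValiantsHypothesis.ValiantsHypothesis.Theorems.NumTame

end
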